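import Summits.ValiantsHypothesis.ValiantsHypothesis.Theorems.UlrichPaddedNoTightInfinityRefutation
import Summits.ValiantsHypothesis.ValiantsHypothesis.Theorems.OrbitCorankTwo.Negative.ConstGaugeInvariance

/-!
# `UlrichPadded.OrbitCorankTwo` (stmt-ValiantsHypothesis-15032): constant gauges do not suffice

Negative knowledge for the crux (standing disprover, cycle 1, 2026-08-16): the natural strengthening
of `OrbitCorankTwo` in which the gauge matrices `P, Q` are CONSTANT (`GL_m(ℂ)` instead of
`GL_m(ℂ[x])`) is FALSE — unconditional form of
`OrbitCorankTwoNegative.not_orbitCorankTwo_constGauge_of_tight`, the tight representation being the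
twisted Grenet `(1+V)·G₇·(1+U)` of `UlrichPaddedNoTightInfinity_refuted` (stmt-ValiantsHypothesis-5668):
constant-gauge invariance of the submaximal-minor ideal of the linear part turns the constant-gauge
version into the refuted ungauged item `NoTightInfinity`.  Hence the POLYNOMIAL part of the gauge is
load-bearing in the crux.  Inline statement, no new facts.
-/

noncomputable section

namespace Summit.ValiantsHypothesis.Theorems.OrbitCorankTwoNegative

open MvPolynomial Matrix
open Literature.Computability.AlgebraicComplexity
open Summit.ValiantsHypothesis.ValiantsHypothesis.Theses.UlrichPadded (NoTightInfinity)
open Summit.ValiantsHypothesis.Theorems (UlrichPaddedNoTightInfinity_refuted)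

/-- **Constant gauges do not suffice (`OrbitCorankTwo` with `P, Q ∈ GL_m(ℂ)` is false).**  If every
affine representation had a CONSTANT-gauge form with all submaximal minors of the linear part in
`(per_n)`, then by `adjugate_linPart_mem_of_constGauge` every representation itself would — that is
the refuted `NoTightInfinity` (`UlrichPaddedNoTightInfinity_refuted`, witness the tight twisted Grenet
`(1+V)·G₇·(1+U)`).  So the x-dependent part of the gauge is load-bearing. [folklore] -/
theorem not_orbitCorankTwo_constGauge :
    ¬ ∀ n : ℕ, 3 ≤ n → ∀ (m : ℕ) (A : Matrix (Fin m) (Fin m) (MvPolynomial (Fin n × Fin n) ℂ)),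
      IsAffineDetRepr (perPoly (Fin n) ℂ) A →
      ∃ P Q : Matrix (Fin m) (Fin m) ℂ, IsUnit P ∧ IsUnit Q ∧
        IsAffineDetRepr (perPoly (Fin n) ℂ) (P.map C * A * Q.map C) ∧
        ∀ i j, (Matrix.of fun a b => homogeneousComponent 1
          ((P.map C * A * Q.map C : Matrix (Fin m) (Fin m) (MvPolynomial (Fin n × Fin n) ℂ)) a b)).adjugate i j ∈
          Ideal.span {perPoly (Fin n) ℂ} := by
  intro h
  apply UlrichPaddedNoTightInfinity_refuted
  intro n hn m A hA i j
  obtain ⟨P, Q, hP, hQ, -, hmem⟩ := h n hn m A hA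
  exact adjugate_linPart_mem_of_constGauge P Q hP hQ A _ hmem i j

end Summit.ValiantsHypothesis.Theorems.OrbitCorankTwoNegative
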